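import Summits.PneNP.PneNP.Theses.KrwChromaticSteering
import Literature.Computability.Complexity.CircuitEval
import Literature.Computability.Complexity.CookBridges

/-!
# Birth skeleton (BC3) — crux `FormulaLayerLift` of route `KrwChromaticSteering` (item stmt-PneNP-18540)

The crux is the route's DECLARED RESIDUAL
`FormulaLayerLift : ¬ (Classes.P ⊆ NC1) → PneNP` — "if `P` is not inside non-uniform `NC¹` then
`P ≠ NP`" (S-implied, open-problem grade; the honest gap between the KRW ladder and the summit,
imported by the route and never attacked by it).

THE LINE ("localise at circuit evaluation, then lift"). The hypothesis `P ⊄ NC¹/poly` is first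
LOCALISED at one explicit `P`-complete language — the tree's circuit-evaluation language
`CircEval.EvalLang = {⟨x, d⟩ | the evaluator accepts}` (`CircuitEval.lean`; Ladner 1975: the
circuit value problem is `P`-complete; Arora–Barak 2009, Thm. 6.18 and Thm. 6.30) — and the lift
to the summit is then asked of that single, downward-self-reducible language:

* PROVED here (no `sorry`): `P_subset_polyAdvice_evalLang : Classes.P ⊆ polyAdvice {EvalLang}` —
  every `L ∈ P` reduces to `EvalLang` by a polynomial ADVICE-PROJECTION `x ↦ ⟨x, desc C_|x|⟩`
  (`P_subset_PPoly_holds` = the tableau family, `CircEval.desc`, `CircEval.evalFn_boolPair_desc`,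
  `CircEval.length_desc_le`): Ladner's `P`-hardness of circuit evaluation in the tree's
  reduction currency `polyAdvice` (Arora–Barak Def. 6.16).
* `stub_polyAdviceNC1` (provable, size M): `polyAdvice NC1 ⊆ NC1` — non-uniform `NC¹` absorbs
  polynomial advice (hardwire `a(n)` and the separator as constant `B₂`-gates: size `+ |⟨x, a(n)⟩|`,
  `acDepth + 1`, and `c·⌊log₂(2n+2+p(n))⌋ + c + 1 ≤ c'·⌊log₂ n⌋ + c'`); the `NC¹` twin of
  `polyAdvice_subset_PPoly` (`PolyAdviceClosure.lean`, size only), not in the tree.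
* hence PROVED (`evalLang_not_mem_NC1_of`): `polyAdvice NC1 ⊆ NC1 → ¬ (P ⊆ NC1) → EvalLang ∉ NC1`
  (if `EvalLang ∈ NC1` then `P ⊆ polyAdvice {EvalLang} ⊆ polyAdvice NC1 ⊆ NC1`).
* `stub_evalLangLift` (OPEN — the residual proper, localised): `EvalLang ∉ NC1 → Classes.P ≠ NP`:
  a super-logarithmic depth lower bound for polynomial-size fan-in-2 circuits deciding circuit
  evaluation lifts to `P ≠ NP`. No such lift is in print (the route's own why-it-might-fail:
  "no NC¹-to-NP lift"); it is the imported residual, stated in library vocabulary only.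
* PROVED seam (`pneNP_of_P_ne_NP`): `Classes.P ≠ Nondeterministic.NP → PneNP` by the
  conjecture-free Cook bridges `pneNP_shape_of_P_ne_NP` (`CookBridges.lean`: `p_bool_eq`,
  `CookBridges.np_bool_eq`).

`formulaLayerLift_of_sigs` proves (no `sorry`, no stub used) that the two stub STATEMENTS imply the
crux body `¬ (Classes.P ⊆ NC1) → PneNP`; `FormulaLayerLift_of` concludes the crux BY NAME from the
two stubs by name (A12 registrar shape); `sorry` occurs only inside `stub_*`.

Modulo the proved localisation, `stub_evalLangLift` is equivalent to the crux (and, like the crux,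
to the summit given `P ⊄ NC¹/poly`): that is what "declared residual" means; the skeleton does not
pretend otherwise. What it adds is the exact place where a lift would have to start — one explicit
`P`-complete language with a projection-complete, gate-by-gate self-reducible structure — and the
one reusable library lemma (`polyAdvice NC1 ⊆ NC1`) the localisation needs.

References: R. E. Ladner, *The circuit value problem is log space complete for P*, SIGACT News 7
(1975) 18–20; S. Arora, B. Barak, *Computational Complexity* (2009), Def. 6.16, Thm. 6.18 (proof:
circuit evaluation in `P`, advice hardwired), Thm. 6.30 (`P`-completeness); M. Karchmer, R. Raz,
A. Wigderson, *Super-logarithmic depth lower bounds via the direct sum in communication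
complexity*, Comput. Complexity 5 (1995) §5 [KarchmerRazWigderson1995]; L. Chen, S. Hirahara,
I. C. Oliveira, J. Pich, N. Rajgopal, R. Santhanam, *Beyond natural proofs: hardness magnification
and locality*, ITCS 2020 [arXiv:1911.08297] (why lifts from slightly-superlinear lower bounds for
explicit structured problems are the live mechanism, and their locality barrier).
-/

set_option linter.dupNamespace false -- `Summit.PneNP.PneNP.…` is the layout-mandated namespace

namespace Summit.PneNP.PneNP.Cruxes.FormulaLayerLift.Birth

open Literature.Computability.Complexity
open Literature.Computability.Complexity.CircEval

/-! ### Registered stubs -/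

/-- STUB (provable, M): non-uniform `NC¹` absorbs polynomial advice — `(NC¹)/poly ⊆ NC¹` for the
tree's advice operator `polyAdvice` (`x ↦ ⟨x, a |x|⟩`, `|a n| ≤ p n`): hardwire the advice and the
separator `01` as constant gates (arity `0`, in `B₂`), rename the doubled input positions to the
inputs; size `≤ q(2n+2+p n) + (2n+2+p n)`, `acDepth ≤ c·⌊log₂(2n+2+p n)⌋ + c + 1 ≤ c'·⌊log₂ n⌋ + c'`.
(Arora–Barak 2009, proof of Thm. 6.18 "⊇", with the depth bookkeeping of Def. 6.23.) -/
theorem stub_polyAdviceNC1 :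
    Literature.Computability.Complexity.polyAdvice Literature.Computability.Complexity.NC1 ⊆
      Literature.Computability.Complexity.NC1 := by
  sorry

/-- STUB (OPEN — the residual proper, localised at circuit evaluation): if the circuit-evaluation
language `CircEval.EvalLang` (`P`-complete under polynomial advice-projections,
`P_subset_polyAdvice_evalLang`) has no polynomial-size `O(log n)`-depth fan-in-`2` circuit family,
then `P ≠ NP` (prelude classes). No such lift is in print; this is the route's declared residual,
imported and not attacked. -/
theorem stub_evalLangLift :
    Literature.Computability.Complexity.CircEval.EvalLang ∉ Literature.Computability.Complexity.NC1 →
      Literature.Computability.Complexity.Classes.P ≠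
        Literature.Computability.Complexity.Nondeterministic.NP := by
  sorry

/-! ### Ladner's `P`-hardness of circuit evaluation, in the advice-projection currency (proved) -/

/-- **`P ⊆ {EvalLang}/poly`**: every polynomial-time language reduces to the circuit-evaluation
language by the advice-projection `x ↦ ⟨x, desc C_|x|⟩`, where `(Cₙ)` is the polynomial-size
tableau family of `P ⊆ P/poly` (`P_subset_PPoly_holds`) and `desc` the evaluator's circuit
encoding (`CircEval.evalFn_boolPair_desc`, `CircEval.length_desc_le`). This is the proof of
`PPoly_subset_polyAdvice_P` (Arora–Barak Thm. 6.18) with the hard language named. -/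
theorem P_subset_polyAdvice_evalLang :
    Classes.P ⊆ polyAdvice {CircEval.EvalLang} := by
  intro L hL
  have hL' : L ∈ PPoly := P_subset_PPoly_holds hL
  simp only [PPoly, Set.mem_iUnion] at hL'
  obtain ⟨p, C, hC, hdec⟩ := hL'
  have har : ∀ n, ∀ g ∈ (C n).gates, g.arity ≤ 2 := fun n g hg => (hC n).1 g hg
  refine ⟨EvalLang, Set.mem_singleton _, fun n => desc (C n),
    (p + 1) * (8 * (Polynomial.X + p) + 10), fun n => ?_, fun x => ?_⟩
  · refine (length_desc_le (C n)).trans ?_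
    have hs : (C n).size ≤ p.eval n := (hC n).2
    simp only [Polynomial.eval_mul, Polynomial.eval_add, Polynomial.eval_one, Polynomial.eval_X,
      Polynomial.eval_ofNat]
    exact Nat.mul_le_mul (by omega) (by omega)
  · change x ∈ L ↔ evalFn (boolPair x (desc (C x.length))) = [true]
    rw [evalFn_boolPair_desc x (C x.length) (har x.length), hdec x, List.cons.injEq]
    simp only [and_true]
    exact Set.mem_iff_boolIndicator L x

/-! ### The localisation and the composition (proved) -/

/-- LOCALISATION (no `sorry`): if `NC¹` absorbs polynomial advice, then `P ⊄ NC¹` already fails at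
the circuit-evaluation language: `EvalLang ∈ NC1` would give
`P ⊆ {EvalLang}/poly ⊆ (NC¹)/poly ⊆ NC¹`. -/
theorem evalLang_not_mem_NC1_of
    (hclos : polyAdvice NC1 ⊆ NC1) (h : ¬ (Classes.P ⊆ NC1)) : CircEval.EvalLang ∉ NC1 := by
  intro hE
  apply h
  intro L hL
  obtain ⟨L', hL', a, p, ha, hiff⟩ := P_subset_polyAdvice_evalLang hL
  rw [Set.mem_singleton_iff] at hL'
  subst hL'
  exact hclos ⟨EvalLang, hE, a, p, ha, hiff⟩

/-- SEAM (no `sorry`): a separation of the prelude classes is Cook's `PneNP`, by the conjecture-free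
model bridges of `CookBridges.lean` (`pneNP_shape_of_P_ne_NP`). -/
theorem pneNP_of_P_ne_NP (h : Classes.P ≠ Nondeterministic.NP) : _root_.PneNP := by
  obtain ⟨L, hL, hL'⟩ := pneNP_shape_of_P_ne_NP h
  show ∃ L : Language Bool, L ∈ PNPWave0.NP Bool ∧ L ∉ PNPWave0.P Bool
  exact ⟨L, hL, hL'⟩

/-- COMPOSITION, implication form (kernel-checked, no `sorry`, no stub used): the two stub
STATEMENTS imply the crux body `¬ (Classes.P ⊆ NC1) → PneNP`. -/
theorem formulaLayerLift_of_sigs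
    (hclos : polyAdvice NC1 ⊆ NC1)
    (hlift : CircEval.EvalLang ∉ NC1 → Classes.P ≠ Nondeterministic.NP) :
    ¬ (Classes.P ⊆ NC1) → _root_.PneNP :=
  fun h => pneNP_of_P_ne_NP (hlift (evalLang_not_mem_NC1_of hclos h))

/-- **THE SKELETON THEOREM `FormulaLayerLift_of`** (A12 shape): the crux
`Summit.PneNP.PneNP.Theses.KrwChromaticSteering.FormulaLayerLift`, concluded BY NAME from the two
declared stubs by name; its only debt is the two `stub_*` sorries. -/
theorem FormulaLayerLift_of :
    Summit.PneNP.PneNP.Theses.KrwChromaticSteering.FormulaLayerLift :=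
  formulaLayerLift_of_sigs stub_polyAdviceNC1 stub_evalLangLift

end Summit.PneNP.PneNP.Cruxes.FormulaLayerLift.Birth
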